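import Summits.BirchSwinnertonDyer.BirchSwinnertonDyer.Theorems.AdditiveBranchIMCGenusKolyvaginTwistCongruence
import HarnessLib

/-!
# Crux `GordTwoRankZeroOffCaseOne` (+ twin `MultLower`): the genus transport `Θ` in the SKELETON'S spelling and with
# the `DecidableEq` instance of the field as an ARGUMENT (adapters for concrete subfields of `ℂ`)

Cell `bsd-addord`, lead seat `cruxlead-19357` (g2); HELPER for `stub_genusKolyvaginPointsR[M]`, landed
`--supports … --as helper`. THEOREMS ONLY (no definition, no named fact, no `sorry`).

WHY. The transport lemmas of `…GenusKolyvaginTransport` (p665133) and the congruence transport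
`GenusKolyvagin.frobCongruentModPlace_twist` (p671608) are stated for an ARBITRARY `ℚ`-field `L` and spell
`ι_θ⁻¹` as `(untwistEquivAt _ _).symm`; elaborated generically, they carry the CLASSICAL `DecidableEq L` in the
group law of `E(L)`. The line's skeleton (`GenusHeegnerSetting.hP`), bsd-stepL's K4e and every ring-class-field
file of the tree work at the concrete subfields `K″[m] ⊂ ℂ`, whose `DecidableEq` instance is the subtype one, and
spell `ι_θ⁻¹` as `(pointEquiv _ (untwistAt hθ)).symm ∘ (congrEquiv (untwistAt_smul_eq …)).symm` (the tree's
`pointGalHom` takes `[DecidableEq L]` as an argument for exactly this reason). This file restates the five transport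
facts the label package needs with `[DecidableEq L]` as an instance ARGUMENT and in the skeleton's spelling; each
proof replaces the instance by the classical one (`Subsingleton.elim`) and invokes the generic lemma, the two
spellings being definitionally equal (`GenusKolyvagin.twist_apply_eq`).

* `pointGalHom_twist'` — `σ(ΘP) = u(σ) • Θ(σP)`, `u(σ) = σθ/θ = ±1`;
* `map_twist_of_eq_intCast_mul'` — `f_*(Θ_θ P) = u • Θ_{θ′}(f_* P)` for `f θ = u θ′`;
* `twist_sum_smul_pointGalHom'` — `Θ(Σ s_i g_i P) = Σ g_i Θ(P)` for `g_i θ = s_i θ` (label (B2));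
* `twist_injective'`, `isOfFinAddOrder_twist'` — `Θ` is injective and preserves finite order;
* `frobCongruentModPlace_twist'` — the (B5) transport of p671608, skeleton spelling, every `(Ω, e, 𝒪)`.

HONEST FRAMING: bookkeeping (no mathematics beyond p665133/p671608). BSD is not proved by any of this.
[cite: SilvermanAEC2009, X.2 Prop. 2.4, X.5 Cor. 5.4 (iii), VII.2 Prop. 2.1]
presearch: n/a (adapter layer; `lean search 'pointGalHom_twist|frobCongruentModPlace_twist'` → the generic forms only).
-/

noncomputable section

set_option linter.dupNamespace false
set_option autoImplicit false

namespace Summit.BirchSwinnertonDyer.BirchSwinnertonDyer.Theorems.GenusKolyvagin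

open WeierstrassCurve Literature.NumberTheory.EllipticCurves

universe v w

section Algebra

variable (E' : WeierstrassCurve ℚ) (D C₂ : VariableChange ℚ) [(D • E').IsCharNeTwoNF] (d : ℚ)
  {L : Type v} [Field L] [Algebra ℚ L] [instL : DecidableEq L] {θ : L}
  {L' : Type w} [Field L'] [Algebra ℚ L'] [instL' : DecidableEq L'] {θ' : L'}

/-- **`σ(Θ P) = u(σ) • Θ(σ P)`** for every `σ ∈ Aut_ℚ(L)` with `σθ = uθ`, `u = ±1` — p665133's `pointGalHom_twist` in
the skeleton's spelling, for an arbitrary `DecidableEq L`. [cite: SilvermanAEC2009, X.2 Prop. 2.4, X.5 Cor. 5.4] -/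
theorem pointGalHom_twist' (hθ2 : θ ^ 2 = algebraMap ℚ L d) (hθ : θ ≠ 0) (σ : L ≃ₐ[ℚ] L) {u : ℤ}
    (hu : u = 1 ∨ u = -1) (hσ : σ θ = (u : L) * θ) (P : (E'.baseChange L).toAffine.Point) :
    pointGalHom (C₂ • (D • E').quadraticTwist d) L σ
        (VariableChange.pointEquivBaseChange ((D • E').quadraticTwist d) C₂ L
          ((VariableChange.pointEquiv (((D • E').quadraticTwist d).baseChange L) (untwistAt hθ)).symm
            ((Affine.Point.congrEquiv (untwistAt_smul_eq (D • E') hθ2 hθ)).symm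
              (VariableChange.pointEquivBaseChange E' D L P)))) =
      u • VariableChange.pointEquivBaseChange ((D • E').quadraticTwist d) C₂ L
          ((VariableChange.pointEquiv (((D • E').quadraticTwist d).baseChange L) (untwistAt hθ)).symm
            ((Affine.Point.congrEquiv (untwistAt_smul_eq (D • E') hθ2 hθ)).symm
              (VariableChange.pointEquivBaseChange E' D L (pointGalHom E' L σ P)))) := by
  have hi : instL = fun a b => Classical.propDecidable (a = b) := Subsingleton.elim _ _
  subst hi
  exact pointGalHom_twist E' D C₂ d hθ2 hθ σ hu hσ P

/-- **`f_*(Θ_θ P) = u • Θ_{θ′}(f_* P)` when `f θ = u θ′`, `u = ±1`** — p665133's `map_twist_of_eq_intCast_mul`,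
skeleton spelling, arbitrary `DecidableEq` instances. [cite: SilvermanAEC2009, X.5 Cor. 5.4 (iii)] -/
theorem map_twist_of_eq_intCast_mul' (hθ2 : θ ^ 2 = algebraMap ℚ L d) (hθ : θ ≠ 0)
    (hθ'2 : θ' ^ 2 = algebraMap ℚ L' d) (hθ' : θ' ≠ 0) (f : L →ₐ[ℚ] L') {u : ℤ} (hu : u = 1 ∨ u = -1)
    (hf : f θ = (u : L') * θ') (P : (E'.baseChange L).toAffine.Point) :
    Affine.Point.map f (VariableChange.pointEquivBaseChange ((D • E').quadraticTwist d) C₂ L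
          ((VariableChange.pointEquiv (((D • E').quadraticTwist d).baseChange L) (untwistAt hθ)).symm
            ((Affine.Point.congrEquiv (untwistAt_smul_eq (D • E') hθ2 hθ)).symm
              (VariableChange.pointEquivBaseChange E' D L P)))) =
      u • VariableChange.pointEquivBaseChange ((D • E').quadraticTwist d) C₂ L'
          ((VariableChange.pointEquiv (((D • E').quadraticTwist d).baseChange L') (untwistAt hθ')).symm
            ((Affine.Point.congrEquiv (untwistAt_smul_eq (D • E') hθ'2 hθ')).symm
              (VariableChange.pointEquivBaseChange E' D L' (Affine.Point.map f P)))) := by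
  have hi : instL = fun a b => Classical.propDecidable (a = b) := Subsingleton.elim _ _
  subst hi
  have hi' : instL' = fun a b => Classical.propDecidable (a = b) := Subsingleton.elim _ _
  subst hi'
  exact map_twist_of_eq_intCast_mul E' D C₂ d hθ2 hθ hθ'2 hθ' f hu hf P

/-- **`Θ(Σ_i s_i • g_i P) = Σ_i g_i • Θ(P)` for `g_i θ = s_i θ`, `s_i = ±1`** — p665133's `twist_sum_smul_pointGalHom`
(the genus-point identity behind label (B2)), skeleton spelling. [cite: SilvermanAEC2009, X.2 Prop. 2.4] -/
theorem twist_sum_smul_pointGalHom' {ι : Type*} (hθ2 : θ ^ 2 = algebraMap ℚ L d) (hθ : θ ≠ 0)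
    (T : Finset ι) (g : ι → (L ≃ₐ[ℚ] L)) (s : ι → ℤ) (hs : ∀ i ∈ T, s i = 1 ∨ s i = -1)
    (hg : ∀ i ∈ T, g i θ = (s i : L) * θ) (P : (E'.baseChange L).toAffine.Point) :
    VariableChange.pointEquivBaseChange ((D • E').quadraticTwist d) C₂ L
        ((VariableChange.pointEquiv (((D • E').quadraticTwist d).baseChange L) (untwistAt hθ)).symm
          ((Affine.Point.congrEquiv (untwistAt_smul_eq (D • E') hθ2 hθ)).symm
            (VariableChange.pointEquivBaseChange E' D L (∑ i ∈ T, s i • pointGalHom E' L (g i) P)))) =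
      ∑ i ∈ T, pointGalHom (C₂ • (D • E').quadraticTwist d) L (g i)
        (VariableChange.pointEquivBaseChange ((D • E').quadraticTwist d) C₂ L
          ((VariableChange.pointEquiv (((D • E').quadraticTwist d).baseChange L) (untwistAt hθ)).symm
            ((Affine.Point.congrEquiv (untwistAt_smul_eq (D • E') hθ2 hθ)).symm
              (VariableChange.pointEquivBaseChange E' D L P)))) := by
  have hi : instL = fun a b => Classical.propDecidable (a = b) := Subsingleton.elim _ _
  subst hi
  exact twist_sum_smul_pointGalHom E' D C₂ d hθ2 hθ T g s hs hg P

/-- `Θ` is injective (skeleton spelling). [folklore] -/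
theorem twist_injective' (hθ2 : θ ^ 2 = algebraMap ℚ L d) (hθ : θ ≠ 0) :
    Function.Injective fun P : (E'.baseChange L).toAffine.Point =>
      VariableChange.pointEquivBaseChange ((D • E').quadraticTwist d) C₂ L
        ((VariableChange.pointEquiv (((D • E').quadraticTwist d).baseChange L) (untwistAt hθ)).symm
          ((Affine.Point.congrEquiv (untwistAt_smul_eq (D • E') hθ2 hθ)).symm
            (VariableChange.pointEquivBaseChange E' D L P))) :=
  fun _ _ h =>
    (VariableChange.pointEquivBaseChange E' D L).injective
      ((Affine.Point.congrEquiv (untwistAt_smul_eq (D • E') hθ2 hθ)).symm.injective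
        ((VariableChange.pointEquiv (((D • E').quadraticTwist d).baseChange L) (untwistAt hθ)).symm.injective
          ((VariableChange.pointEquivBaseChange ((D • E').quadraticTwist d) C₂ L).injective h)))

/-- `Θ` preserves finite order (a composite of additive maps). [folklore] -/
theorem isOfFinAddOrder_twist' (hθ2 : θ ^ 2 = algebraMap ℚ L d) (hθ : θ ≠ 0)
    {P : (E'.baseChange L).toAffine.Point} (hP : IsOfFinAddOrder P) :
    IsOfFinAddOrder (VariableChange.pointEquivBaseChange ((D • E').quadraticTwist d) C₂ L
        ((VariableChange.pointEquiv (((D • E').quadraticTwist d).baseChange L) (untwistAt hθ)).symm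
          ((Affine.Point.congrEquiv (untwistAt_smul_eq (D • E') hθ2 hθ)).symm
            (VariableChange.pointEquivBaseChange E' D L P)))) :=
  (VariableChange.pointEquivBaseChange ((D • E').quadraticTwist d) C₂ L).toAddMonoidHom.isOfFinAddOrder <|
    (VariableChange.pointEquiv (((D • E').quadraticTwist d).baseChange L)
        (untwistAt hθ)).symm.toAddMonoidHom.isOfFinAddOrder <|
      (Affine.Point.congrEquiv (untwistAt_smul_eq (D • E') hθ2 hθ)).symm.toAddMonoidHom.isOfFinAddOrder <|
        (VariableChange.pointEquivBaseChange E' D L).toAddMonoidHom.isOfFinAddOrder hP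

end Algebra

section Congruence

variable (E' : WeierstrassCurve ℚ) [E'.IsGloballyMinimal] (D C₂ : VariableChange ℚ) [(D • E').IsCharNeTwoNF]
  (d : ℤ) [(C₂ • (D • E').quadraticTwist (d : ℚ)).IsGloballyMinimal]
  {L : Type} [Field L] [CharZero L] [Algebra ℚ L] [instL : DecidableEq L]

/-- **The (B5) transport of p671608 in the skeleton's spelling, at every place** (`[DecidableEq L]` an argument):
if `P ≡ Frob_ℓ(P₀)` on `E′` modulo every valuation subring over `ℓ` of every field receiving `L`, then
`Θ_ϑ(P) ≡ Frob_ℓ(Θ_{ϑ′}(P₀))` on `Wd = C₂ • (D • E′)^{(d)}` likewise, for the roots `ϑ = (d/ℓ)·ϑ′`.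
[cite: SilvermanAEC2009, VII.2 Prop. 2.1, VII.1 Prop. 1.3 (b)] [cite: GrossLMS1991, Prop. 3.7 (2)] -/
theorem frobCongruentModPlace_twist' {ℓ : ℕ} [Fact ℓ.Prime] (hℓ2 : ℓ ≠ 2) (hℓd : ¬ (ℓ : ℤ) ∣ d)
    (hℓE : ¬ (ℓ : ℤ) ∣ minimalDiscriminantInt E')
    (hℓW : ¬ (ℓ : ℤ) ∣ minimalDiscriminantInt (C₂ • (D • E').quadraticTwist (d : ℚ)))
    {ϑ ϑ' : L} (hϑ2 : ϑ ^ 2 = algebraMap ℚ L (d : ℚ)) (hϑ : ϑ ≠ 0)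
    (hϑ'2 : ϑ' ^ 2 = algebraMap ℚ L (d : ℚ)) (hϑ' : ϑ' ≠ 0)
    (hsign : ϑ = ((legendreSym ℓ d : ℤ) : L) * ϑ') {P P₀ : (E'.baseChange L).toAffine.Point}
    (h : ∀ (Ω : Type) [Field Ω] (e : L →+* Ω) (𝒪 : ValuationSubring Ω), (ℓ : Ω) ∈ 𝒪.nonunits →
      FrobCongruentModPlace 𝒪 ℓ ((E'.baseChange L).mapPointHom e P) ((E'.baseChange L).mapPointHom e P₀)) :
    ∀ (Ω : Type) [Field Ω] (e : L →+* Ω) (𝒪 : ValuationSubring Ω), (ℓ : Ω) ∈ 𝒪.nonunits →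
      FrobCongruentModPlace 𝒪 ℓ
        (((C₂ • (D • E').quadraticTwist (d : ℚ)).baseChange L).mapPointHom e
          (VariableChange.pointEquivBaseChange ((D • E').quadraticTwist (d : ℚ)) C₂ L
            ((VariableChange.pointEquiv (((D • E').quadraticTwist (d : ℚ)).baseChange L) (untwistAt hϑ)).symm
              ((Affine.Point.congrEquiv (untwistAt_smul_eq (D • E') hϑ2 hϑ)).symm
                (VariableChange.pointEquivBaseChange E' D L P)))))
        (((C₂ • (D • E').quadraticTwist (d : ℚ)).baseChange L).mapPointHom e
          (VariableChange.pointEquivBaseChange ((D • E').quadraticTwist (d : ℚ)) C₂ L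
            ((VariableChange.pointEquiv (((D • E').quadraticTwist (d : ℚ)).baseChange L) (untwistAt hϑ')).symm
              ((Affine.Point.congrEquiv (untwistAt_smul_eq (D • E') hϑ'2 hϑ')).symm
                (VariableChange.pointEquivBaseChange E' D L P₀))))) := by
  have hi : instL = fun a b => Classical.propDecidable (a = b) := Subsingleton.elim _ _
  subst hi
  intro Ω _ e 𝒪 hℓ𝒪
  exact frobCongruentModPlace_twist (E' := E') (D := D) (C₂ := C₂) (d := d) hℓ2 hℓd hℓE hℓW hϑ2 hϑ hϑ'2 hϑ'
    hsign e 𝒪 hℓ𝒪 (h Ω e 𝒪 hℓ𝒪)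

end Congruence

end Summit.BirchSwinnertonDyer.BirchSwinnertonDyer.Theorems.GenusKolyvagin

end
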